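import Summits.CriticalPhenomena.CardyFormulaZ2.Theses.CardyViaSLE6
import Literature.Probability.RandomPlanarGeometry.ConformalRestrictionProofs
import HarnessLib

/-!
# Route `CardyViaSLE6`: typed split of the crux r2 `ConformalCovarianceOfSubseqLimits`
(stmt-CriticalPhenomena-0763) — the assembly, proved (crux-dir copy; the Theorems-ready file is the evidence `CardyViaSLE6ConformalCovarianceOfSubseqLimitsSplit.lean` on stmt-0763, namespace `…Theorems.CardyViaSLE6`)

Sub-problem `CriticalPhenomena/CardyFormulaZ2`, route `CardyViaSLE6`.  The crux
`Summit.CriticalPhenomena.CardyFormulaZ2.Theses.CardyViaSLE6.ConformalCovarianceOfSubseqLimits`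
(conformal covariance of subsequential interface limits of bond-`ℤ²` percolation along a common mesh
sequence) is cut along Beffara's existence / symmetry dichotomy (Beffara 2008 = arXiv:0708.3908,
Prop. 4: an embedding-blind argument proves existence-type statements for every sheared copy of the
lattice at once, conformal covariance for at most one shear):

* **X₁ `InterfaceLimitExists`** — the scaling limit of the exploration interface EXISTS,
  independently of the admissible discretisation: for every Dobrushin domain `D` there is one
  probability law `μ_D` on `CurveClass ℂ` to which the interfaces of every
  `ZdDiscretisationFamily D E` converge weakly as `δ → 0⁺` (the open scale-invariance / uniqueness
  problem on `ℤ²`, DKKMO 2020 §1.1; Schramm–Smirnov 2011 §1);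
* **X₂ `LimitFamilyConformalCovariance`** — IF a chordal family `P` of probability laws is the full
  scaling limit of the bond-`ℤ²` interfaces (every domain, every admissible family) THEN `P` is
  conformally covariant (`ChordalFamily.IsConformallyCovariant`) — the symmetry half, where the
  embedding-specific inputs (DKKMO rotation invariance; the exact lattice Markov property and
  locality) must enter.

This file proves the ASSEMBLY `X₁ → X₂ → ConformalCovarianceOfSubseqLimits`
(`conformalCovarianceOfSubseqLimits_of_subs`, hypotheses written out literally as the two child
statements): soft measure theory — the limit family `P D := μ_D` given by X₁ satisfies the
hypothesis of X₂, hence is conformally covariant; the two subsequential limits `μ, μ'` of the crux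
are identified with `P D`, `P D'` by uniqueness of limits of real sequences (`tendsto_nhds_unique`
along the common sequence `s`), and `P D' = Φ_* (P D)` is unfolded on test functions by
`integral_map` with the continuity of `CurveClass.map Φ` (`CurveClass.continuous_map`).
Axioms: propext, Classical.choice, Quot.sound.
-/

noncomputable section

open Filter Topology MeasureTheory
open scoped BoundedContinuousFunction
open Literature.Probability.RandomPlanarGeometry Literature.Probability.LatticeModels
  Literature.Probability.Percolation

namespace Summit.CriticalPhenomena.CardyFormulaZ2.Cruxes.ConformalCovarianceOfSubseqLimits

/-- **Assembly of the split of r2 (stmt-CriticalPhenomena-0763).**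
`InterfaceLimitExists → LimitFamilyConformalCovariance → ConformalCovarianceOfSubseqLimits`, the
two hypotheses being written out literally (they are the child statements of the split, rendered as
route decls by the gate).  Proof: choose the limit law `P D` of X₁ for every domain; X₂ makes `P`
conformally covariant; along the crux's common mesh sequence `s` the given subsequential limits
`μ, μ'` have the same test-function integrals as `P D, P D'` (`tendsto_nhds_unique`); then
`P D' = (P D).map (CurveClass.map Φ)` and `integral_map`.  (Beffara 2008, Prop. 4, for the shape of
the cut; Billingsley 1999, Thm 2.7 / Lawler 2005, §6.1 for the measure theory.) [folklore] -/
theorem conformalCovarianceOfSubseqLimits_of_subs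
    (h₁ : ∀ D : Literature.Probability.RandomPlanarGeometry.DobrushinDomain, ∃ μ : MeasureTheory.Measure (Literature.Probability.RandomPlanarGeometry.CurveClass ℂ), MeasureTheory.IsProbabilityMeasure μ ∧ ∀ (E : ℝ → Literature.Probability.LatticeModels.DiscreteDobrushin), Literature.Probability.LatticeModels.ZdDiscretisationFamily D E → ∀ f : BoundedContinuousFunction (Literature.Probability.RandomPlanarGeometry.CurveClass ℂ) ℝ, Filter.Tendsto (fun δ => ∫ ω, f (Literature.Probability.Percolation.bondInterfaceIn D (E δ) ω) ∂(Literature.Probability.Percolation.bondPercolation (Literature.Probability.LatticeModels.zdGraph 2) Literature.Probability.Percolation.half)) (nhdsWithin 0 (Set.Ioi 0)) (nhds (∫ γ, f γ ∂μ)))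
    (h₂ : ∀ P : Literature.Probability.RandomPlanarGeometry.ChordalFamily, (∀ D, MeasureTheory.IsProbabilityMeasure (P D)) → (∀ (D : Literature.Probability.RandomPlanarGeometry.DobrushinDomain) (E : ℝ → Literature.Probability.LatticeModels.DiscreteDobrushin), Literature.Probability.LatticeModels.ZdDiscretisationFamily D E → ∀ f : BoundedContinuousFunction (Literature.Probability.RandomPlanarGeometry.CurveClass ℂ) ℝ, Filter.Tendsto (fun δ => ∫ ω, f (Literature.Probability.Percolation.bondInterfaceIn D (E δ) ω) ∂(Literature.Probability.Percolation.bondPercolation (Literature.Probability.LatticeModels.zdGraph 2) Literature.Probability.Percolation.half)) (nhdsWithin 0 (Set.Ioi 0)) (nhds (∫ γ, f γ ∂(P D)))) → P.IsConformallyCovariant) :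
    Theses.CardyViaSLE6.ConformalCovarianceOfSubseqLimits := by
  intro D D' g Φ hg0 hg1 hΦ E E' hE hE' s hs μ μ' _ _ hμ hμ' f
  classical
  -- the limit family of X₁
  choose P hP using h₁
  have hprob : ∀ D, IsProbabilityMeasure (P D) := fun D => (hP D).1
  have hlim : ∀ (D : DobrushinDomain) (E : ℝ → DiscreteDobrushin), ZdDiscretisationFamily D E →
      ∀ f : CurveClass ℂ →ᵇ ℝ, Tendsto (fun δ => ∫ ω, f (bondInterfaceIn D (E δ) ω)
        ∂(bondPercolation (zdGraph 2) half)) (𝓝[>] 0) (𝓝 (∫ γ, f γ ∂(P D))) :=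
    fun D E hE f => (hP D).2 E hE f
  -- X₂: the family is conformally covariant
  have hcov : ChordalFamily.IsConformallyCovariant P := h₂ P hprob hlim
  -- identification of the two subsequential limits with the family along `s`
  have hμP : ∀ f : CurveClass ℂ →ᵇ ℝ, ∫ γ, f γ ∂μ = ∫ γ, f γ ∂(P D) := fun f =>
    tendsto_nhds_unique (hμ f) ((hlim D E hE f).comp hs)
  have hμ'P : ∀ f : CurveClass ℂ →ᵇ ℝ, ∫ γ, f γ ∂μ' = ∫ γ, f γ ∂(P D') := fun f =>
    tendsto_nhds_unique (hμ' f) ((hlim D' E' hE' f).comp hs)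
  -- covariance at `(D, D', g, Φ)`
  have hPD' : P D' = (P D).map (CurveClass.map Φ) := hcov D D' g Φ hg0 hg1 hΦ
  -- the test function `f ∘ CurveClass.map Φ` is bounded continuous
  set fΦ : CurveClass ℂ →ᵇ ℝ := f.compContinuous ⟨CurveClass.map Φ, CurveClass.continuous_map Φ⟩
    with hfΦ
  calc ∫ γ, f γ ∂μ' = ∫ γ, f γ ∂(P D') := hμ'P f
    _ = ∫ γ, f γ ∂((P D).map (CurveClass.map Φ)) := by rw [hPD']
    _ = ∫ γ, f (CurveClass.map Φ γ) ∂(P D) :=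
        integral_map (CurveClass.measurable_map Φ).aemeasurable f.continuous.aestronglyMeasurable
    _ = ∫ γ, fΦ γ ∂(P D) := by simp [hfΦ]
    _ = ∫ γ, fΦ γ ∂μ := (hμP fΦ).symm
    _ = ∫ γ, f (CurveClass.map Φ γ) ∂μ := by simp [hfΦ]

end Summit.CriticalPhenomena.CardyFormulaZ2.Cruxes.ConformalCovarianceOfSubseqLimits
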